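import Summits.Ventures.LatticeQCDFlow.Exactness.Phi4HMCFluctuationRelation
import Summits.Ventures.LatticeQCDFlow.Exactness.MetropolisLineEnergyBound
import HarnessLib

/-!
# The mean squared ACCEPTED change of the energy — and of the action — in one deterministic-proposal Metropolis step

HONEST FRAMING: exact (Metropolis-corrected) sampling algorithms for lattice gauge theory;
figures of merit are autocorrelation/cost numbers at stated couplings and volumes; no
continuum-physics claim.  (SCALAR calibration rung S0-A: not a gauge result.)

Venture `LatticeQCDFlow` (cell pub-lqcd), topic `Exactness`; FANOUT row 2 (`s0-phi4`, HMC arm: the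
mechanism of CRITICAL SLOWING DOWN OF THE ACTION under HMC-type updates, typed).  NEW WORK of the
cell over the tree's involutive-Metropolis vocabulary (`involAccept`, `deltaH`,
`integral_involAccept_comp`, `creutz_integral`) and the one-line estimate
`MetropolisLineEnergyBound.accept_mul_sq_le` (`min(1, e^{−Δ}) Δ² ≤ 4e^{−2}(1 + e^{−Δ})`).  Nothing is
cited as a fact.  Printed counterpart of the FIRST estimate, NAMED ONLY: Caracciolo–Pelissetto–Sokal,
*A general limitation on Monte Carlo algorithms of Metropolis type*, Phys. Rev. Lett. 72 (1994) 179,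
Proposition (`⟨(ΔH)²⟩ ≤ 8/e²` per Metropolis step, discrete state space, local or non-local
proposals); here it is the deterministic-proposal (phase-space) form.  The SECOND estimate — the
action moves only through the energy violation and the exchange with the kinetic energy, so its mean
squared accepted change per update is bounded by `16/e²` plus `8×` the equilibrium variance of the
kinetic energy, WHATEVER the proposal map — is the cell's composition (presearch: corpus hybrid /
vector, galaxy `star all`: no printed statement found; Kennedy–Pendleton 2001 treat the free field
mode by mode).

## Setting

A measurable space `X` with a measure `μ` ("phase space", Lebesgue), an energy `H : X → ℝ`, a
proposal map `Ψ : X → X` that is a measurable `μ`-preserving INVOLUTION (flip ∘ any reversible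
volume-preserving integrator, any step size and length — or the exact Hamiltonian flow), the
Metropolis test `a = involAccept H Ψ = min(1, e^{−ΔH})`, `ΔH = deltaH H Ψ = H∘Ψ − H`.

## What is proved

* `involAccept_mul_deltaH_sq_le` — pointwise `a (ΔH)² ≤ 4e^{−2}(1 + e^{−ΔH})`;
* **`integral_involAccept_mul_deltaH_sq_le`** — `∫ a (ΔH)² e^{−H} ≤ 8e^{−2} ∫ e^{−H}` (CPS on phase
  space: `∫ e^{−ΔH} e^{−H} = ∫ e^{−H}` is Creutz's identity);
* **`integral_involAccept_mul_comp_le`** — ACCEPTED-ENDPOINT DOMINATION: for `G ≥ 0`,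
  `∫ a (G∘Ψ) e^{−H} = ∫ a G e^{−H} ≤ ∫ G e^{−H}` (what is found at the accepted endpoint is, in
  equilibrium, distributed no worse than at the start);
* `sq_sub_le_of_split` — the pointwise algebra `a (f∘Ψ − f)² ≤ 2 a(ΔH)² + 4 a((K∘Ψ) − c)² + 4 (K − c)²`
  when `H = S + K` and `f` moves no more than `S`;
* **`integral_involAccept_mul_sq_sub_le_of_kinetic`** — for `H = S + K` pointwise, every `f` with
  `|f(Ψ z) − f(z)| ≤ |S(Ψ z) − S(z)|` and every constant `c`:
  `∫ a (f∘Ψ − f)² e^{−H} ≤ 16e^{−2} ∫ e^{−H} + 8 ∫ (K − c)² e^{−H}`.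

The lattice assembly (Gaussian momenta: `∫ (K − V/2)² = (V/2)·Z`, hence the floor
`τ_int,traj(f(S)) ≥ Var(f(S))/(2V + 8/e²) − ½` for row 2's HMC) is
`Exactness/Phi4HMCActionCSD.lean`.  NOT CLAIMED: anything about partial momentum refreshment
(GHMC), which is not an instance of this setting.
-/

namespace Summit.Ventures.LatticeQCDFlow.Exactness

open Real MeasureTheory Filter

section General

variable {X : Type*} [MeasurableSpace X] {μ : Measure X}

omit [MeasurableSpace X] in
/-- **Pointwise CPS bound for a deterministic proposal**: the Metropolis-weighted squared energy
violation obeys `a(z) (H(Ψ z) − H(z))² ≤ 4e^{−2} (1 + e^{−ΔH(z)})`. -/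
theorem involAccept_mul_deltaH_sq_le (H : X → ℝ) (Ψ : X → X) (z : X) :
    involAccept H Ψ z * (H (Ψ z) - H z) ^ 2
      ≤ 4 * Real.exp (-2) * (1 + Real.exp (-deltaH H Ψ z)) := by
  rw [involAccept_eq_min_exp_neg_deltaH]
  exact accept_mul_sq_le (deltaH H Ψ z)

/-- `e^{−H∘Ψ}` is integrable when `e^{−H}` is (measure preservation), written as `e^{−ΔH} e^{−H}`. -/
theorem integrable_exp_neg_deltaH_mul {H : X → ℝ} {Ψ : X → X}
    (hΨμ : MeasurePreserving Ψ μ μ) (hw : Integrable (fun z => Real.exp (-H z)) μ) :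
    Integrable (fun z => Real.exp (-deltaH H Ψ z) * Real.exp (-H z)) μ := by
  have h : Integrable (fun z => Real.exp (-H (Ψ z))) μ :=
    (hΨμ.integrable_comp hw.aestronglyMeasurable).mpr hw
  exact h.congr (Eventually.of_forall fun z => (exp_neg_deltaH_mul_exp_neg H Ψ z).symm)

/-- The Metropolis-weighted squared energy violation `a (ΔH)² e^{−H}` is integrable when `e^{−H}` is. -/
theorem integrable_involAccept_mul_deltaH_sq {H : X → ℝ} {Ψ : X → X} (hH : Measurable H)
    (hΨm : Measurable Ψ) (hΨμ : MeasurePreserving Ψ μ μ)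
    (hw : Integrable (fun z => Real.exp (-H z)) μ) :
    Integrable (fun z => involAccept H Ψ z * (H (Ψ z) - H z) ^ 2 * Real.exp (-H z)) μ := by
  have hR : Integrable (fun z => 4 * Real.exp (-2)
      * (Real.exp (-H z) + Real.exp (-deltaH H Ψ z) * Real.exp (-H z))) μ :=
    (hw.add (integrable_exp_neg_deltaH_mul hΨμ hw)).const_mul _
  refine Integrable.mono' hR
    ((((measurable_involAccept hH hΨm).mul (((hH.comp hΨm).sub hH).pow_const 2)).mul
      (Real.measurable_exp.comp hH.neg)).aestronglyMeasurable) (Eventually.of_forall fun z => ?_)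
  have ha0 := involAccept_nonneg H Ψ z
  have hw0 : 0 ≤ Real.exp (-H z) := (Real.exp_pos _).le
  rw [Real.norm_eq_abs, abs_of_nonneg (mul_nonneg (mul_nonneg ha0 (sq_nonneg _)) hw0)]
  have h := mul_le_mul_of_nonneg_right (involAccept_mul_deltaH_sq_le H Ψ z) hw0
  calc involAccept H Ψ z * (H (Ψ z) - H z) ^ 2 * Real.exp (-H z)
      ≤ 4 * Real.exp (-2) * (1 + Real.exp (-deltaH H Ψ z)) * Real.exp (-H z) := h
    _ = 4 * Real.exp (-2) * (Real.exp (-H z) + Real.exp (-deltaH H Ψ z) * Real.exp (-H z)) := by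
        ring

/-- **THE MEAN SQUARED ACCEPTED ENERGY VIOLATION IS AT MOST `8/e²` (Caracciolo–Pelissetto–Sokal, on
phase space).**  `Ψ` a measurable `μ`-preserving involution, `H` measurable with `e^{−H}` integrable:
`∫ a (H∘Ψ − H)² e^{−H} dμ ≤ 8e^{−2} ∫ e^{−H} dμ`. -/
theorem integral_involAccept_mul_deltaH_sq_le {H : X → ℝ} {Ψ : X → X}
    (hΨm : Measurable Ψ) (hΨi : Function.Involutive Ψ) (hΨμ : MeasurePreserving Ψ μ μ)
    (hw : Integrable (fun z => Real.exp (-H z)) μ) :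
    ∫ z, involAccept H Ψ z * (H (Ψ z) - H z) ^ 2 * Real.exp (-H z) ∂μ
      ≤ 8 * Real.exp (-2) * ∫ z, Real.exp (-H z) ∂μ := by
  have hwΨ := integrable_exp_neg_deltaH_mul (H := H) hΨμ hw
  have hR : Integrable (fun z => 4 * Real.exp (-2)
      * (Real.exp (-H z) + Real.exp (-deltaH H Ψ z) * Real.exp (-H z))) μ :=
    (hw.add hwΨ).const_mul _
  have hmono : ∫ z, involAccept H Ψ z * (H (Ψ z) - H z) ^ 2 * Real.exp (-H z) ∂μ
      ≤ ∫ z, 4 * Real.exp (-2)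
          * (Real.exp (-H z) + Real.exp (-deltaH H Ψ z) * Real.exp (-H z)) ∂μ := by
    refine integral_mono_of_nonneg (Eventually.of_forall fun z => ?_) hR
      (Eventually.of_forall fun z => ?_)
    · exact mul_nonneg (mul_nonneg (involAccept_nonneg H Ψ z) (sq_nonneg _)) (Real.exp_pos _).le
    · have hw0 : 0 ≤ Real.exp (-H z) := (Real.exp_pos _).le
      have h := mul_le_mul_of_nonneg_right (involAccept_mul_deltaH_sq_le H Ψ z) hw0
      calc involAccept H Ψ z * (H (Ψ z) - H z) ^ 2 * Real.exp (-H z)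
          ≤ 4 * Real.exp (-2) * (1 + Real.exp (-deltaH H Ψ z)) * Real.exp (-H z) := h
        _ = 4 * Real.exp (-2) * (Real.exp (-H z) + Real.exp (-deltaH H Ψ z) * Real.exp (-H z)) := by
            ring
  rw [integral_const_mul, integral_add hw hwΨ, creutz_integral hΨm hΨi hΨμ] at hmono
  linarith

/-- **ACCEPTED-ENDPOINT DOMINATION.**  For a measurable `μ`-preserving involution `Ψ` and every
`G ≥ 0` with `G e^{−H}` integrable: `∫ a(z) G(Ψ z) e^{−H z} dμ ≤ ∫ G e^{−H} dμ` — the law of an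
observable read at the ACCEPTED endpoint of the move is dominated by the equilibrium law (the
identity `∫ a (G∘Ψ) e^{−H} = ∫ a G e^{−H}` is `integral_involAccept_comp`; then `a ≤ 1`). -/
theorem integral_involAccept_mul_comp_le {H : X → ℝ} {Ψ : X → X} (hΨm : Measurable Ψ)
    (hΨi : Function.Involutive Ψ) (hΨμ : MeasurePreserving Ψ μ μ) {G : X → ℝ}
    (hG0 : ∀ z, 0 ≤ G z) (hGw : Integrable (fun z => G z * Real.exp (-H z)) μ) :
    ∫ z, involAccept H Ψ z * G (Ψ z) * Real.exp (-H z) ∂μ ≤ ∫ z, G z * Real.exp (-H z) ∂μ := by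
  rw [integral_involAccept_comp hΨm hΨi hΨμ G]
  refine integral_mono_of_nonneg (Eventually.of_forall fun z => ?_) hGw
    (Eventually.of_forall fun z => ?_)
  · exact mul_nonneg (mul_nonneg (involAccept_nonneg H Ψ z) (hG0 z)) (Real.exp_pos _).le
  · have h1 := involAccept_le_one H Ψ z
    have h0 : 0 ≤ G z * Real.exp (-H z) := mul_nonneg (hG0 z) (Real.exp_pos _).le
    calc involAccept H Ψ z * G z * Real.exp (-H z)
        = involAccept H Ψ z * (G z * Real.exp (-H z)) := by ring
      _ ≤ 1 * (G z * Real.exp (-H z)) := mul_le_mul_of_nonneg_right h1 h0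
      _ = G z * Real.exp (-H z) := one_mul _

omit [MeasurableSpace X] in
/-- **The pointwise algebra of the kinetic exchange.**  If `H = S + K` pointwise and `f` moves no
more than `S` along the proposal (`|f(Ψ z) − f(z)| ≤ |S(Ψ z) − S(z)|`), then for every constant `c`
`a (f∘Ψ − f)² ≤ 2 a (ΔH)² + 4 a ((K∘Ψ) − c)² + 4 (K − c)²`
(`ΔS = ΔH − ΔK`, two Cauchy splits, `a ≤ 1` on the last term). -/
theorem sq_sub_le_of_split {H S K : X → ℝ} (Ψ : X → X) (hsplit : ∀ z, H z = S z + K z)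
    {f : X → ℝ} (hfS : ∀ z, |f (Ψ z) - f z| ≤ |S (Ψ z) - S z|) (c : ℝ) (z : X) :
    involAccept H Ψ z * (f (Ψ z) - f z) ^ 2
      ≤ 2 * (involAccept H Ψ z * (H (Ψ z) - H z) ^ 2)
        + 4 * (involAccept H Ψ z * (K (Ψ z) - c) ^ 2) + 4 * (K z - c) ^ 2 := by
  have ha0 := involAccept_nonneg H Ψ z
  have ha1 := involAccept_le_one H Ψ z
  have hf2 : (f (Ψ z) - f z) ^ 2 ≤ (S (Ψ z) - S z) ^ 2 := by
    rw [← sq_abs, ← sq_abs (S (Ψ z) - S z)]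
    exact pow_le_pow_left₀ (abs_nonneg _) (hfS z) 2
  have hS : S (Ψ z) - S z = (H (Ψ z) - H z) - ((K (Ψ z) - c) - (K z - c)) := by
    rw [hsplit (Ψ z), hsplit z]
    ring
  have hsq : (S (Ψ z) - S z) ^ 2
      ≤ 2 * (H (Ψ z) - H z) ^ 2 + 4 * (K (Ψ z) - c) ^ 2 + 4 * (K z - c) ^ 2 := by
    rw [hS]
    nlinarith [sq_nonneg ((H (Ψ z) - H z) + ((K (Ψ z) - c) - (K z - c))),
      sq_nonneg ((K (Ψ z) - c) + (K z - c))]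
  have h1 : involAccept H Ψ z * (f (Ψ z) - f z) ^ 2
      ≤ involAccept H Ψ z * (2 * (H (Ψ z) - H z) ^ 2 + 4 * (K (Ψ z) - c) ^ 2 + 4 * (K z - c) ^ 2) :=
    mul_le_mul_of_nonneg_left (hf2.trans hsq) ha0
  have h2 : involAccept H Ψ z * (4 * (K z - c) ^ 2) ≤ 1 * (4 * (K z - c) ^ 2) :=
    mul_le_mul_of_nonneg_right ha1 (by positivity)
  nlinarith [h1, h2]

/-- **THE MEAN SQUARED ACCEPTED CHANGE OF THE ACTION UNDER A KINETIC-EXCHANGE UPDATE.**  `Ψ` a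
measurable `μ`-preserving involution; `H = S + K` pointwise with `H`, `K` measurable, `e^{−H}` and
`(K − c)² e^{−H}` integrable; `f` any observable moving no more than `S` along `Ψ`.  Then
`∫ a (f∘Ψ − f)² e^{−H} dμ ≤ 16e^{−2} ∫ e^{−H} dμ + 8 ∫ (K − c)² e^{−H} dμ`:
the action changes by the energy violation (`≤ 8/e²` in mean square, CPS) plus the change of the
kinetic energy, whose accepted-endpoint law is dominated by equilibrium. -/
theorem integral_involAccept_mul_sq_sub_le_of_kinetic {H S K : X → ℝ} {Ψ : X → X}
    (hH : Measurable H) (hK : Measurable K) (hΨm : Measurable Ψ) (hΨi : Function.Involutive Ψ)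
    (hΨμ : MeasurePreserving Ψ μ μ) (hsplit : ∀ z, H z = S z + K z)
    (hw : Integrable (fun z => Real.exp (-H z)) μ) (c : ℝ)
    (hKw : Integrable (fun z => (K z - c) ^ 2 * Real.exp (-H z)) μ)
    {f : X → ℝ} (hfS : ∀ z, |f (Ψ z) - f z| ≤ |S (Ψ z) - S z|) :
    ∫ z, involAccept H Ψ z * (f (Ψ z) - f z) ^ 2 * Real.exp (-H z) ∂μ
      ≤ 16 * Real.exp (-2) * (∫ z, Real.exp (-H z) ∂μ)
        + 8 * ∫ z, (K z - c) ^ 2 * Real.exp (-H z) ∂μ := by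
  set G : X → ℝ := fun z => (K z - c) ^ 2 with hG
  have hG0 : ∀ z, 0 ≤ G z := fun z => sq_nonneg _
  have hGm : Measurable G := (hK.sub measurable_const).pow_const 2
  -- the three integrable pieces of the majorant
  have hI1 := integrable_involAccept_mul_deltaH_sq hH hΨm hΨμ hw
  have hI2 : Integrable (fun z => involAccept H Ψ z * G (Ψ z) * Real.exp (-H z)) μ :=
    integrable_involAccept_comp_mul hH hΨm hΨμ hGm hKw
  have hI3 : Integrable (fun z => G z * Real.exp (-H z)) μ := hKw
  have h12 : Integrable (fun z => 2 * (involAccept H Ψ z * (H (Ψ z) - H z) ^ 2 * Real.exp (-H z))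
      + 4 * (involAccept H Ψ z * G (Ψ z) * Real.exp (-H z))) μ :=
    (hI1.const_mul 2).add (hI2.const_mul 4)
  have hR : Integrable (fun z => 2 * (involAccept H Ψ z * (H (Ψ z) - H z) ^ 2 * Real.exp (-H z))
      + 4 * (involAccept H Ψ z * G (Ψ z) * Real.exp (-H z)) + 4 * (G z * Real.exp (-H z))) μ :=
    h12.add (hI3.const_mul 4)
  have hmono : ∫ z, involAccept H Ψ z * (f (Ψ z) - f z) ^ 2 * Real.exp (-H z) ∂μ
      ≤ ∫ z, (2 * (involAccept H Ψ z * (H (Ψ z) - H z) ^ 2 * Real.exp (-H z))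
          + 4 * (involAccept H Ψ z * G (Ψ z) * Real.exp (-H z)) + 4 * (G z * Real.exp (-H z))) ∂μ := by
    refine integral_mono_of_nonneg (Eventually.of_forall fun z => ?_) hR
      (Eventually.of_forall fun z => ?_)
    · exact mul_nonneg (mul_nonneg (involAccept_nonneg H Ψ z) (sq_nonneg _)) (Real.exp_pos _).le
    · have hw0 : 0 ≤ Real.exp (-H z) := (Real.exp_pos _).le
      have h := mul_le_mul_of_nonneg_right (sq_sub_le_of_split Ψ hsplit hfS c z) hw0
      simp only [hG]
      calc involAccept H Ψ z * (f (Ψ z) - f z) ^ 2 * Real.exp (-H z)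
          ≤ (2 * (involAccept H Ψ z * (H (Ψ z) - H z) ^ 2)
              + 4 * (involAccept H Ψ z * (K (Ψ z) - c) ^ 2) + 4 * (K z - c) ^ 2) * Real.exp (-H z) := h
        _ = 2 * (involAccept H Ψ z * (H (Ψ z) - H z) ^ 2 * Real.exp (-H z))
              + 4 * (involAccept H Ψ z * (K (Ψ z) - c) ^ 2 * Real.exp (-H z))
              + 4 * ((K z - c) ^ 2 * Real.exp (-H z)) := by ring
  have hsplitI : ∫ z, (2 * (involAccept H Ψ z * (H (Ψ z) - H z) ^ 2 * Real.exp (-H z))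
          + 4 * (involAccept H Ψ z * G (Ψ z) * Real.exp (-H z)) + 4 * (G z * Real.exp (-H z))) ∂μ
      = 2 * (∫ z, involAccept H Ψ z * (H (Ψ z) - H z) ^ 2 * Real.exp (-H z) ∂μ)
        + 4 * (∫ z, involAccept H Ψ z * G (Ψ z) * Real.exp (-H z) ∂μ)
        + 4 * ∫ z, G z * Real.exp (-H z) ∂μ := by
    rw [integral_add h12 (hI3.const_mul 4), integral_add (hI1.const_mul 2) (hI2.const_mul 4),
      integral_const_mul, integral_const_mul, integral_const_mul]
  rw [hsplitI] at hmono
  have hA := integral_involAccept_mul_deltaH_sq_le hΨm hΨi hΨμ hw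
  have hB := integral_involAccept_mul_comp_le (H := H) hΨm hΨi hΨμ hG0 hI3
  simp only [hG] at hmono hB
  linarith [hmono, hA, hB]

end General

end Summit.Ventures.LatticeQCDFlow.Exactness
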